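import Literature.NumberTheory.Kottwitz1992.FunctorialIsomorphisms
import Mathlib.RepresentationTheory.Coinvariants
import Mathlib.GroupTheory.SemidirectProduct
import Mathlib.GroupTheory.QuotientGroup.Basic
import HarnessLib

/-!
# Kottwitz 1985, «Isocrystals with additional structure» — the rows the tree cites: `B(G)` as `σ`-conjugacy classes
# (1.7), the formal exactness (1.9.1), and §2 (tori): Lemma 2.2 (a), Proposition 2.3, 2.4

R. E. Kottwitz, *Isocrystals with additional structure*, Compositio Math. **56** (1985) 201–220
[Kottwitz1985Isocrystals] (= the reference [K3] of [Kottwitz1992]).  Source of record: the NUMDAM digitisation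
`http://www.numdam.org/item/CM_1985__56_2_201_0/`, materialised as `paper:url-9dcb8dbab652` (21 pdf pages; **pdf page
= printed page − 199**, p0002 = p. 201); every pin below was read on those pages (OCR prose; formulas re-read in
context).  Squad TK carpet (cell `hodgecm-mathlib`, seat TK-t04, deal v3.1 (4)); topic
`NumberTheory/Kottwitz1985Isocrystals`, namespace `Literature.NumberTheory.Kottwitz1985Isocrystals.CitedRows`.
STATEMENTS ONLY: definitions with bodies + `Prop`-valued named facts / predicates; no theorem, no `sorry`, no `axiom`,
no instance, no notation.

SCOPE (deal: «type ONLY the rows the tree leans on»).  Tree census (02:25Z): 3 `[cite: Kottwitz1985Isocrystals, §2]`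
tags — ★ `Kottwitz1992/FunctorialIsomorphisms` (`BT` = `B(T)`, `Kottwitz1992_12_kottwitzMap_characterization`) and
★ `Kottwitz1992/CMPolarized` (the identity `[b] = -f(μ)` in `B(T_{ℚ_p})`) — plus the [K3] sentences of [Kottwitz1992]
§12 p. 412 («As in [K3] … we write `B(T)` for the group `T(L)/{t σ(t)⁻¹ | t ∈ T(L)}`», «In §2 of [K3] a functorial
isomorphism `f : X_*(T)_Γ → B(T)` is constructed … the unique homomorphism of functors … that for `𝔾_m` sends
`1 ∈ ℤ = X_*(𝔾_m)_Γ` to the element of `B(𝔾_m)` represented by `p`») and §14 p. 419 / §16 p. 431 (`σ`-conjugacy classes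
in `G(L_r)`, «every element of `D(𝒪_L)` is `σ`-conjugate to the identity (see [K3])»).  Hence: 1.7 (`B(G)`), 1.9.1,
Lemma 2.2 (a), Proposition 2.3 (with its key step `B(𝔾_m) ≅ ℤ` by the valuation), 2.4.  NOT typed (no tree row):
1.8 (`H¹(L, G) = 1` ⇒ `B(G) = H¹(W(K̄/F), G(K̄))`, the injection `H¹(F, G) ↪ B(G)`), 1.10 (Shapiro), Lemma 2.2 (b) for
a GENERAL additive functor `A` (typed for `A = B` only, inside 2.4), 2.5 (explicit formula `μ ↦ Nm_{E/E₀} μ(π_E)`),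
2.6–2.8, §§3–6 (Dieudonné–Manin, the Newton map `ν`, basic elements, `B(G)_b ≅ X^*(Z(Ĝ)^Γ)` — [Kottwitz1992] uses the
latter through [K5] §6, not through [K3]).

## Source, verbatim

§1 (p. 203): «`k` — an algebraically closed field of characteristic `p > 0`; `K` — the fraction field of the Witt
ring `W(k)`; … `F` — a finite extension of `ℚ_p` in `K̄`; … `L` — the compositum of `K` and `F` in `K̄`; `Γ` — the
Galois group of `F̄/F`», 1.1 «The Frobenius automorphism of `k` relative to `k_F` induces an automorphism of `K` over
`M`, which in turn induces an automorphism `σ` of `L` over `F`», 1.2 «LEMMA: The fixed field of `σ` on `L` is `F`.»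
**1.7** (p. 204): «Let `G` be an algebraic group over `F`. We define `B(G)` to be the pointed set `H¹(⟨σ⟩, G(L))`. More
concretely, `B(G)` is the quotient of `G(L)` by the equivalence relation `σ`-conjugacy: `x, y ∈ G(L)` are said to be
`σ`-conjugate if there exists `g ∈ G(L)` such that `y = g x σ(g)⁻¹`. Note that `x, y` are `σ`-conjugate if and only if
the elements `xσ, yσ` of the semidirect product `G(L) ⋊ ⟨σ⟩` are conjugate under `G(L)`.»  **1.9** (p. 205): «Let
`1 → G₁ → G₂ → G₃ → 1` be an exact sequence of algebraic groups over `F`, and assume that `G₁` is connected and linear.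
Since `H¹(L, G₁)` is trivial, the sequence `1 → G₁(L) → G₂(L) → G₃(L) → 1` is exact. Taking cohomology with respect to
the group `⟨σ⟩` and using 1.2, we get an exact sequence (1.9.1) `… → B(G₁) → B(G₂) → B(G₃)`. The surjectivity of
`B(G₂) → B(G₃)` is an immediate consequence of the surjectivity of `G₂(L) → G₃(L)`.»  **§2** (pp. 205–208): «2.1.
Consider additive functors `A : (F-tori) → (abelian groups)` satisfying the following two conditions: (2.1.1)
`A(R_{E/F}𝔾_m)` is isomorphic to `ℤ` for any `E`. (2.1.2) For any exact sequence `1 → T₁ → T₂ → T₃ → 1` of `F`-tori,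
the sequence `A(T₁) → A(T₂) → A(T₃) → 1` is exact.»  «2.2. LEMMA. (a) The functor `T ↦ X_*(T)_Γ` satisfies the
conditions of 2.1 (we use a subscript `Γ` to denote the coinvariants of `Γ`). (b) Assume that `A` satisfies the
conditions of 2.1. Then `A` is isomorphic to the functor `X_*(·)_Γ` of (a), and the canonical homomorphism
`Hom(X_*(·)_Γ, A) → A(𝔾_m)` is an isomorphism. (2.2.1)»  «2.3. PROPOSITION: The functor `T ↦ B(T)` satisfies the two
conditions of 2.1. … it suffices to show that `B(𝔾_m)` is isomorphic to `ℤ`. For this it is enough to show that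
`x ∈ L^×` is of the form `y σ(y)⁻¹` (`y ∈ L^×`) if and only if the valuation of `x` is `0`. … Condition (2.1.2)
follows immediately from (1.9.1).»  «2.4. The results in 2.2 and 2.3 show that the functors `X_*(·)_Γ` and `B` are
isomorphic, and that choosing an isomorphism `X_*(·)_Γ ⥲ B` (2.4.1) is the same as choosing a generator of the
infinite cyclic group `B(𝔾_m)`. We normalize (2.4.1) by choosing as generator of `B(𝔾_m)` the `σ`-conjugacy class
in `L^×` consisting of elements with normalized valuation `1`.»

## Models (tree notions; no new posit)

* 1.7 / 1.9.1 are typed for an ARBITRARY group `G` (standing for `G(L)`) with an endomorphism `σ : G →* G` — real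
  definitions `IsSigmaConjugate`, `BSet` (= `Quot`), `BSet.base`; the convention `y = g x σ(g)⁻¹` is the print's and agrees
  with ★ `Kottwitz1992/FixedPointCount.twistedCentralizer`; ★ `Kottwitz1992/KottwitzTriples` POSITS the relation
  `IsSigmaConj` on its carrier `GLr` — dictionary: that field IS `IsSigmaConjugate σ` for `G = G(L_r)`.
* §2 is typed on the MODEL of ★ `Kottwitz1992/FunctorialIsomorphisms` (imported, not re-posited): `F = ℚ_p` («in
  this introduction we discuss only the case `F = ℚ_p`», p. 201; the case [Kottwitz1992] uses), `(Q, L, σ, eL)` with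
  `IsLDatum p k Q L σ eL` (`L = Frac W(k)`, `k = 𝔽̄_p`, `Q = L^σ = ℚ_p` — 1.2), tori SPLIT BY a fixed finite Galois
  `K/ℚ_p` as `Gal(K/ℚ_p)`-lattices `(Y, ρ)` (= `X_*(T)`), `T(L) = TL`, `B(T) = BT ⊆ BigQ`, `𝔾_m = (ℤ, trivial)`,
  `[p] = pClass u`.  `R_{E/ℚ_p}𝔾_m` for `ℚ_p ⊆ E ⊆ K` is the permutation lattice `ℤ[Gal(K/ℚ_p)/Gal(K/E)]`
  (`Representation.ofMulAction ℤ G (G ⧸ N)`, `N` a normal subgroup of `G = Gal(K/ℚ_p)`); `X_*(T)_Γ` is Mathlib's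
  `Representation.Coinvariants ρ` (`Γ` acts through `Gal(K/ℚ_p)`).
  -- TODO(general form): `F/ℚ_p` finite, ALL `F`-tori (K85 §2 works with the pro-torus `"lim" R_{E/F}𝔾_m`), and `k`
  -- ANY algebraically closed field of characteristic `p` (K85 p. 203; the model's `IsLDatum` takes `k = 𝔽̄_p` as in
  -- [Kottwitz1992]); the `K`-split subcategory is the one [Kottwitz1992] §12 needs («the methods of §2 of [K3] still
  -- apply», p. 413).

HC_CM is proved only modulo the 7 printed citations until rung 0 closes; nothing here bears on them.

## References
* [Kottwitz1985Isocrystals] §1 (1.1, 1.2, 1.7, 1.9) pp. 203–205; §2 (2.1–2.4) pp. 205–208.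
* [Kottwitz1992] §12 p. 412–413 (the [K3] sentences), §16 p. 431.
-/

noncomputable section

open scoped TensorProduct Isocrystal
open Representation

namespace Literature.NumberTheory.Kottwitz1985Isocrystals.CitedRows

open Literature.NumberTheory.Kottwitz1992.FunctorialIsomorphisms

/-! ## 1.7 (p. 204): `σ`-conjugacy and the pointed set `B(G)` -/

section SigmaConj

variable {G : Type*} [Group G] (σ : G →* G)

/-- **`σ`-conjugacy** [K3, 1.7 (p. 204)]: «`x, y ∈ G(L)` are said to be `σ`-conjugate if there exists `g ∈ G(L)` such
that `y = g x σ(g)⁻¹`» — for any group `G` (standing for `G(L)`) with an endomorphism `σ` (the Frobenius of `L` acting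
on `G(L)`). [cite: Kottwitz1985Isocrystals, 1.7 (p. 204)] -/
def IsSigmaConjugate (x y : G) : Prop :=
  ∃ g : G, y = g * x * (σ g)⁻¹

/-- **`B(G)`** [K3, 1.7 (p. 204)]: «the quotient of `G(L)` by the equivalence relation `σ`-conjugacy» (= the pointed
set `H¹(⟨σ⟩, G(L))`), as the quotient type by `IsSigmaConjugate σ`. [cite: Kottwitz1985Isocrystals, 1.7 (p. 204)] -/
def BSet : Type _ := Quot (IsSigmaConjugate σ)

/-- The class `[x] ∈ B(G)` of `x ∈ G(L)`. [cite: Kottwitz1985Isocrystals, 1.7 (p. 204)] -/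
def BSet.mk (x : G) : BSet σ := Quot.mk _ x

/-- The base point of the pointed set `B(G)`: the class of `1`. [cite: Kottwitz1985Isocrystals, 1.7 (p. 204)] -/
def BSet.base : BSet σ := BSet.mk σ 1

/-- **[K3, 1.7 (p. 204)], the remark**, verbatim: «Note that `x, y` are `σ`-conjugate if and only if the elements
`xσ, yσ` of the semidirect product `G(L) ⋊ ⟨σ⟩` are conjugate under `G(L)`.»  Typed for an AUTOMORPHISM `σ`, with
`⟨σ⟩` the infinite cyclic group `Multiplicative ℤ` acting through `n ↦ σⁿ` (Mathlib `SemidirectProduct`, `zpowersHom`).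
[cite: Kottwitz1985Isocrystals, 1.7 (p. 204)] -/
def Kottwitz1985_1_7_sigmaConj_iff_conj_semidirect : Prop :=
  ∀ (G : Type) [Group G] (σ : MulAut G) (x y : G),
    IsSigmaConjugate (σ : G →* G) x y ↔
      ∃ g : G,
        (SemidirectProduct.inl y * SemidirectProduct.inr (Multiplicative.ofAdd (1 : ℤ)) :
            G ⋊[zpowersHom (MulAut G) σ] Multiplicative ℤ) =
          SemidirectProduct.inl g * (SemidirectProduct.inl x * SemidirectProduct.inr (Multiplicative.ofAdd (1 : ℤ))) *
            (SemidirectProduct.inl g)⁻¹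

end SigmaConj

/-! ## 1.9.1 (p. 205): exactness of `B(G₁) → B(G₂) → B(G₃)` and surjectivity of `B(G₂) → B(G₃)` -/

/-- **[K3, (1.9.1) (p. 205)]**, the formal part: for groups `G₁ →ι G₂ →π G₃` (standing for the `L`-points of an exact
sequence `1 → G₁ → G₂ → G₃ → 1` of algebraic groups over `F`) with compatible endomorphisms `σᵢ`, `ι` injective, `π`
SURJECTIVE («since `H¹(L, G₁)` is trivial [for `G₁` connected linear], the sequence `1 → G₁(L) → G₂(L) → G₃(L) → 1` is
exact» — entered as the hypothesis) and `ker π = im ι`: the sequence of pointed sets `B(G₁) → B(G₂) → B(G₃)` is exact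
at `B(G₂)` and «the surjectivity of `B(G₂) → B(G₃)` is an immediate consequence of the surjectivity of
`G₂(L) → G₃(L)`».  Stated on representatives. [cite: Kottwitz1985Isocrystals, (1.9.1) (p. 205)] -/
def Kottwitz1985_1_9_1_exact : Prop :=
  ∀ (G₁ G₂ G₃ : Type) [Group G₁] [Group G₂] [Group G₃] (σ₁ : G₁ →* G₁) (σ₂ : G₂ →* G₂) (σ₃ : G₃ →* G₃)
    (ι : G₁ →* G₂) (π : G₂ →* G₃),
    (∀ x, ι (σ₁ x) = σ₂ (ι x)) → (∀ x, π (σ₂ x) = σ₃ (π x)) → Function.Injective ι → Function.Surjective π →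
    π.ker = ι.range →
      (∀ x₂ : G₂, IsSigmaConjugate σ₃ 1 (π x₂) ↔ ∃ x₁ : G₁, IsSigmaConjugate σ₂ (ι x₁) x₂) ∧
      (∀ x₃ : G₃, ∃ x₂ : G₂, IsSigmaConjugate σ₃ (π x₂) x₃)

/-! ## §2 (pp. 205–208) on the model of ★ `Kottwitz1992.FunctorialIsomorphisms` (`F = ℚ_p`, tori split by `K`) -/

section Tori

variable (p : ℕ) [Fact p.Prime] (k : Type) [Field k] [CharP k p] [IsAlgClosed k]
variable (Q : Type) [Field Q] (L : Type) [Field L] [Algebra Q L] (σ : L ≃ₐ[Q] L) (eL : L ≃+* K(p, k))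
variable (K : Type) [Field K] [Algebra Q K] [FiniteDimensional Q K] [IsGalois Q K]

/-- **[K3, Lemma 2.2 (a) (p. 206)]**: «The functor `T ↦ X_*(T)_Γ` satisfies the conditions of 2.1» — on the model:
(2.1.1) for every normal subgroup `N` of `G = Gal(K/ℚ_p)` (i.e. every Galois `E ⊆ K`, `R_{E/ℚ_p}𝔾_m` having
cocharacter lattice `ℤ[G/N]` with `G` acting by left translation) the coinvariants `ℤ[G/N]_G` are isomorphic to `ℤ`;
(2.1.2) for every short exact sequence `0 → Y₁ → Y₂ → Y₃ → 0` of `Gal(K/ℚ_p)`-lattices (= exact sequence of `K`-split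
tori) the sequence of coinvariants is right exact.  («Part (a) is an easy exercise», p. 206 — `X_*(T)_Γ` = Mathlib's
`Representation.Coinvariants`.) [cite: Kottwitz1985Isocrystals, Lemma 2.2 (a) (p. 206)] -/
def Kottwitz1985_2_2_a_coinvariants : Prop :=
  (∀ N : Subgroup (K ≃ₐ[Q] K), N.Normal →
      Nonempty ((Representation.ofMulAction ℤ (K ≃ₐ[Q] K) ((K ≃ₐ[Q] K) ⧸ N)).Coinvariants ≃ₗ[ℤ] ℤ)) ∧
  ∀ (Y₁ Y₂ Y₃ : Type) [AddCommGroup Y₁] [Module.Finite ℤ Y₁] [Module.Free ℤ Y₁] [AddCommGroup Y₂]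
    [Module.Finite ℤ Y₂] [Module.Free ℤ Y₂] [AddCommGroup Y₃] [Module.Finite ℤ Y₃] [Module.Free ℤ Y₃]
    (ρ₁ : Representation ℤ (K ≃ₐ[Q] K) Y₁) (ρ₂ : Representation ℤ (K ≃ₐ[Q] K) Y₂)
    (ρ₃ : Representation ℤ (K ≃ₐ[Q] K) Y₃) (φ : Y₁ →ₗ[ℤ] Y₂) (ψ : Y₂ →ₗ[ℤ] Y₃),
    (∀ g, φ ∘ₗ ρ₁ g = ρ₂ g ∘ₗ φ) → (∀ g, ψ ∘ₗ ρ₂ g = ρ₃ g ∘ₗ ψ) →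
    Function.Injective φ → Function.Surjective ψ → LinearMap.ker ψ = LinearMap.range φ →
      (∀ c : ρ₃.Coinvariants, ∃ y₂ : Y₂, Coinvariants.mk ρ₃ (ψ y₂) = c) ∧
      (∀ y₂ : Y₂, Coinvariants.mk ρ₃ (ψ y₂) = 0 ↔ ∃ y₁ : Y₁, Coinvariants.mk ρ₂ y₂ = Coinvariants.mk ρ₂ (φ y₁))

/-- **[K3, Proposition 2.3, key step (p. 207)]**, verbatim: «it is enough to show that `x ∈ L^×` is of the form
`y σ(y)⁻¹` (`y ∈ L^×`) if and only if the valuation of `x` is `0`» (proved there: `β(y) = y σ(y)⁻¹` maps `𝒪_L^×`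
ONTO `𝒪_L^×` because `k` is algebraically closed) — i.e. `B(𝔾_m) ≅ ℤ` by the valuation.  On the model: `L = Frac W(k)`
via `eL`, «valuation `0`» = `eL x` is a unit of the Witt ring `W(k)`. [cite: Kottwitz1985Isocrystals, Proposition 2.3 (p. 207)] -/
def Kottwitz1985_2_3_sigmaConj_one_iff_unit : Prop :=
  IsLDatum p k Q L σ eL →
    ∀ x : Lˣ, (∃ y : Lˣ, (x : L) = y * (σ (y : L))⁻¹) ↔
      ∃ w : (WittVector p k)ˣ, eL x = algebraMap (WittVector p k) K(p, k) (w : WittVector p k)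

/-- **[K3, Proposition 2.3 (p. 207)]**: «The functor `T ↦ B(T)` satisfies the two conditions of 2.1» — on the model
(`B(T) = BT`, ★ `FunctorialIsomorphisms`): (2.1.1) for every normal subgroup `N` of `Gal(K/ℚ_p)`, `B(R_{E/ℚ_p}𝔾_m)`
(`E = K^N`) is infinite cyclic, and `B(𝔾_m)` is infinite cyclic GENERATED BY `[p]` (2.4's normalisation for `F = ℚ_p`:
«the `σ`-conjugacy class in `L^×` consisting of elements with normalized valuation `1`»); (2.1.2) for every short
exact sequence of `Gal(K/ℚ_p)`-lattices `0 → Y₁ →φ Y₂ →ψ Y₃ → 0` the sequence `B(T₁) → B(T₂) → B(T₃) → 0` is exact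
(«follows immediately from (1.9.1)»), stated on representatives `t ∈ T(L) = TL`.
[cite: Kottwitz1985Isocrystals, Proposition 2.3 (p. 207), 2.4 (p. 208)] -/
def Kottwitz1985_2_3_B_satisfies_2_1 : Prop :=
  IsLDatum p k Q L σ eL →
    (∀ N : Subgroup (K ≃ₐ[Q] K), N.Normal →
      ∃ b ∈ BT Q L σ K _ (Representation.ofMulAction ℤ (K ≃ₐ[Q] K) ((K ≃ₐ[Q] K) ⧸ N)),
        (∀ n : ℤ, n • b = 0 → n = 0) ∧
        ∀ x ∈ BT Q L σ K _ (Representation.ofMulAction ℤ (K ≃ₐ[Q] K) ((K ≃ₐ[Q] K) ⧸ N)),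
          ∃ n : ℤ, x = n • b) ∧
    (∀ u : Lˣ, (u : L) = (p : L) →
      pClass Q L σ K u ∈ BT Q L σ K ℤ (gmRep Q K) ∧ (∀ n : ℤ, n • pClass Q L σ K u = 0 → n = 0) ∧
        ∀ x ∈ BT Q L σ K ℤ (gmRep Q K), ∃ n : ℤ, x = n • pClass Q L σ K u) ∧
    ∀ (Y₁ Y₂ Y₃ : Type) [AddCommGroup Y₁] [Module.Finite ℤ Y₁] [Module.Free ℤ Y₁] [AddCommGroup Y₂]
      [Module.Finite ℤ Y₂] [Module.Free ℤ Y₂] [AddCommGroup Y₃] [Module.Finite ℤ Y₃] [Module.Free ℤ Y₃]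
      (ρ₁ : Representation ℤ (K ≃ₐ[Q] K) Y₁) (ρ₂ : Representation ℤ (K ≃ₐ[Q] K) Y₂)
      (ρ₃ : Representation ℤ (K ≃ₐ[Q] K) Y₃) (φ : Y₁ →ₗ[ℤ] Y₂) (ψ : Y₂ →ₗ[ℤ] Y₃),
      (∀ g, φ ∘ₗ ρ₁ g = ρ₂ g ∘ₗ φ) → (∀ g, ψ ∘ₗ ρ₂ g = ρ₃ g ∘ₗ ψ) →
      Function.Injective φ → Function.Surjective ψ → LinearMap.ker ψ = LinearMap.range φ →
        -- `B(T₂) → B(T₃)` is onto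
        (∀ t₃ ∈ TL Q L K Y₃ ρ₃, ∃ t₂ ∈ TL Q L K Y₂ ρ₂,
          (NY Q L σ K Y₃ ρ₃).mkQ (TensorProduct.map ψ LinearMap.id t₂) = (NY Q L σ K Y₃ ρ₃).mkQ t₃) ∧
        -- exactness at `B(T₂)`
        (∀ t₂ ∈ TL Q L K Y₂ ρ₂,
          (NY Q L σ K Y₃ ρ₃).mkQ (TensorProduct.map ψ LinearMap.id t₂) = 0 ↔
            ∃ t₁ ∈ TL Q L K Y₁ ρ₁,
              (NY Q L σ K Y₂ ρ₂).mkQ t₂ = (NY Q L σ K Y₂ ρ₂).mkQ (TensorProduct.map φ LinearMap.id t₁))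

/-- **[K3, 2.4 (p. 208)] with Lemma 2.2 (b) for `A = B`**, verbatim: «The results in 2.2 and 2.3 show that the
functors `X_*(·)_Γ` and `B` are isomorphic, and that choosing an isomorphism `X_*(·)_Γ ⥲ B` (2.4.1) is the same as
choosing a generator of the infinite cyclic group `B(𝔾_m)`. We normalize (2.4.1) by choosing as generator of `B(𝔾_m)`
the `σ`-conjugacy class in `L^×` consisting of elements with normalized valuation `1`.»  On the model («homomorphism of
functors `X_*(·)_Γ → B(·)`» = a natural, additive, orbit-constant family `η`, ★ `IsNatural` / `IsAdditiveOnCoinvariants`;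
«isomorphism» = ★ `IsIsoOnCoinvariants`): every element `b ∈ B(𝔾_m)` is the value `η_{𝔾_m}(1)` of exactly one such
family (values compared on every `T ∈ 𝒯`), and that family is an isomorphism iff `b` generates `B(𝔾_m)`.  The
NORMALISED isomorphism (`b = [p]` for `F = ℚ_p`) is the `f` of ★ `Kottwitz1992_12_kottwitzMap_characterization`
(cited, not restated). [cite: Kottwitz1985Isocrystals, 2.4 (p. 208), Lemma 2.2 (b) (p. 206)] -/
def Kottwitz1985_2_4_isomorphisms_eq_generators : Prop :=
  IsLDatum p k Q L σ eL →
    ∀ b ∈ BT Q L σ K ℤ (gmRep Q K),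
      (∃ η : ∀ (Y : Type) [AddCommGroup Y] (ρ : Representation ℤ (K ≃ₐ[Q] K) Y), Y → BigQ Q L σ K Y ρ,
          IsNatural Q L σ K η ∧ IsAdditiveOnCoinvariants Q L σ K η ∧ η ℤ (gmRep Q K) 1 = b) ∧
      (∀ η η' : ∀ (Y : Type) [AddCommGroup Y] (ρ : Representation ℤ (K ≃ₐ[Q] K) Y), Y → BigQ Q L σ K Y ρ,
          IsNatural Q L σ K η → IsAdditiveOnCoinvariants Q L σ K η → η ℤ (gmRep Q K) 1 = b →
          IsNatural Q L σ K η' → IsAdditiveOnCoinvariants Q L σ K η' → η' ℤ (gmRep Q K) 1 = b →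
            ∀ (Y : Type) [AddCommGroup Y] [Module.Finite ℤ Y] [Module.Free ℤ Y]
              (ρ : Representation ℤ (K ≃ₐ[Q] K) Y) (y : Y), η Y ρ y = η' Y ρ y) ∧
      (∀ η : ∀ (Y : Type) [AddCommGroup Y] (ρ : Representation ℤ (K ≃ₐ[Q] K) Y), Y → BigQ Q L σ K Y ρ,
          IsNatural Q L σ K η → IsAdditiveOnCoinvariants Q L σ K η → η ℤ (gmRep Q K) 1 = b →
            (IsIsoOnCoinvariants Q L σ K η ↔ ∀ x ∈ BT Q L σ K ℤ (gmRep Q K), ∃ n : ℤ, x = n • b))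

end Tori

end Literature.NumberTheory.Kottwitz1985Isocrystals.CitedRows

/-! ## ED. 2 (paydown, DEAL v4 P-a): discharges of the two generic rows 1.7 and (1.9.1)

T-ref1 NB-2 (02:35:55Z): «rows 1.7 ∕ 1.9.1 ∕ 2.2(a) are generic algebra provable as typed ⇒ proof-lane candidates».
The two group-theoretic ones are discharged here (pure proofs of the UNCHANGED statements above; Mathlib only).
`Kottwitz1985_2_2_a_coinvariants` (coinvariants of permutation lattices; right exactness of coinvariants) is left as a
fact for now (a `Representation.Coinvariants` computation, not attempted in this edition). -/

namespace Literature.NumberTheory.Kottwitz1985Isocrystals.CitedRows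

/-- Discharge of `Kottwitz1985_1_7_sigmaConj_iff_conj_semidirect`: in `G ⋊ ⟨σ⟩` one has
`g · (x σ) · g⁻¹ = (g x σ(g)⁻¹) σ` (Mathlib's multiplication law of `SemidirectProduct`), so «`xσ, yσ` conjugate under
`G(L)`» is literally `σ`-conjugacy. [cite: Kottwitz1985Isocrystals, 1.7 (p. 204)] -/
theorem Kottwitz1985_1_7_sigmaConj_iff_conj_semidirect_holds : Kottwitz1985_1_7_sigmaConj_iff_conj_semidirect := by
  intro G _ σ x y
  constructor
  · rintro ⟨g, rfl⟩
    refine ⟨g, ?_⟩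
    ext <;> simp [mul_assoc]
  · rintro ⟨g, h⟩
    refine ⟨g, ?_⟩
    have h' := congrArg SemidirectProduct.left h
    simpa [mul_assoc] using h'

/-- Discharge of `Kottwitz1985_1_9_1_exact`: the naive long-exact-sequence step for `H¹(⟨σ⟩, ·)` of a
`σ`-equivariant short exact sequence of groups whose last map is surjective. [cite: Kottwitz1985Isocrystals, (1.9.1) (p. 205)] -/
theorem Kottwitz1985_1_9_1_exact_holds : Kottwitz1985_1_9_1_exact := by
  intro G₁ G₂ G₃ _ _ _ σ₁ σ₂ σ₃ ι π hι hπ hinj hsurj hker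
  refine ⟨fun x₂ => ⟨?_, ?_⟩, fun x₃ => ?_⟩
  · rintro ⟨g₃, hg₃⟩
    obtain ⟨g₂, rfl⟩ := hsurj g₃
    have hmem : g₂⁻¹ * x₂ * σ₂ g₂ ∈ π.ker := by
      rw [MonoidHom.mem_ker, map_mul, map_mul, map_inv, hπ, hg₃]
      group
    rw [hker] at hmem
    obtain ⟨x₁, hx₁⟩ := hmem
    exact ⟨x₁, g₂, by rw [hx₁]; group⟩
  · rintro ⟨x₁, g, rfl⟩
    refine ⟨π g, ?_⟩
    have h1 : π (ι x₁) = 1 := by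
      rw [← MonoidHom.mem_ker, hker]
      exact ⟨x₁, rfl⟩
    rw [map_mul, map_mul, map_inv, hπ, h1]
  · obtain ⟨x₂, rfl⟩ := hsurj x₃
    exact ⟨x₂, 1, by simp⟩

end Literature.NumberTheory.Kottwitz1985Isocrystals.CitedRows


/-! ## ED. 3 (paydown, DEAL v4 P-a): discharge of Lemma 2.2 (a)

`Kottwitz1985_2_2_a_coinvariants` («part (a) is an easy exercise», p. 206) is now PROVED, with the def's own parameters
and no further hypothesis: (2.1.1) the augmentation `ℤ[H] → ℤ` is `G`-invariant and, for a transitive `G`-set `H`,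
identifies the coinvariants of the permutation lattice `ℤ[H]` with `ℤ` (`[x] = [g • x]`, so every `[x]` is `[x₀]`);
(2.1.2) right exactness of coinvariants: a surjective equivariant `ψ` maps the submodule `⟨ρ₂(g) y - y⟩` ONTO
`⟨ρ₃(g) y - y⟩`, and `ker ψ = im φ`.  ED. 2 is byte-identical above this line; Mathlib only. -/

namespace Literature.NumberTheory.Kottwitz1985Isocrystals.CitedRows

open MonoidAlgebra

section HoldsAux

/-- The augmentation `ℤ[H] → ℤ`, `Σ n_x · x ↦ Σ n_x` (helper for `Kottwitz1985_2_2_a_coinvariants_holds`). [folklore] -/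
private noncomputable def aug (H : Type) : MonoidAlgebra ℤ H →ₗ[ℤ] ℤ :=
  (Finsupp.linearCombination ℤ fun _ : H => (1 : ℤ)) ∘ₗ (coeffLinearEquiv ℤ).toLinearMap

/-- The augmentation of `r · x` is `r`. [folklore] -/
private lemma aug_single (H : Type) (x : H) (r : ℤ) : aug H (single x r) = r := by
  simp [aug, Finsupp.linearCombination_single]

variable {G : Type} [Group G] {H : Type} [MulAction G H]

/-- The augmentation is invariant under the permutation representation. [folklore] -/
private lemma aug_comp_ofMulAction (g : G) : aug H ∘ₗ ofMulAction ℤ G H g = aug H := by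
  ext x
  simp [aug_single]

/-- For a transitive `G`-set, every class in the coinvariants of `ℤ[H]` is a multiple of `[x₀]`, the multiplier
being the augmentation. [folklore] -/
private lemma mk_eq_aug_smul [MulAction.IsPretransitive G H] (x₀ : H) (f : MonoidAlgebra ℤ H) :
    Coinvariants.mk (ofMulAction ℤ G H) f = aug H f • Coinvariants.mk (ofMulAction ℤ G H) (single x₀ 1) := by
  induction f using MonoidAlgebra.induction_linear with
  | zero => simp
  | add f₁ f₂ h₁ h₂ => rw [map_add, map_add, h₁, h₂, add_smul]
  | single x r =>
    obtain ⟨g, rfl⟩ := MulAction.exists_smul_eq G x₀ x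
    rw [← ofMulAction_single (k := ℤ) g x₀ r, Coinvariants.mk_self_apply, ofMulAction_single, aug_single,
      ← map_smul, smul_single', mul_one]

/-- (2.1.1) in general: the coinvariants of the permutation lattice of a nonempty transitive `G`-set are `≅ ℤ`
(via the augmentation). [folklore] [cite: Kottwitz1985Isocrystals, Lemma 2.2 (a) (p. 206), condition (2.1.1)] -/
private lemma nonempty_coinvariants_equiv [MulAction.IsPretransitive G H] (x₀ : H) :
    Nonempty ((ofMulAction ℤ G H).Coinvariants ≃ₗ[ℤ] ℤ) := by
  refine ⟨LinearEquiv.ofBijective (Coinvariants.lift (ofMulAction ℤ G H) (aug H) aug_comp_ofMulAction) ⟨?_, ?_⟩⟩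
  · rw [injective_iff_map_eq_zero]
    intro c hc
    induction c using Coinvariants.induction_on with
    | h f =>
      rw [Coinvariants.lift_mk] at hc
      rw [mk_eq_aug_smul x₀ f, hc, zero_smul]
  · intro n
    exact ⟨Coinvariants.mk _ (single x₀ n), by rw [Coinvariants.lift_mk, aug_single]⟩

variable {Y₂ Y₃ : Type} [AddCommGroup Y₂] [AddCommGroup Y₃]

/-- (2.1.2), the key inclusion: a surjective equivariant map sends the augmentation submodule `⟨ρ₂(g) y - y⟩`
onto `⟨ρ₃(g) y - y⟩`. [folklore] [cite: Kottwitz1985Isocrystals, Lemma 2.2 (a) (p. 206), condition (2.1.2)] -/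
private lemma map_coinvariantsKer_eq (ρ₂ : Representation ℤ G Y₂) (ρ₃ : Representation ℤ G Y₃)
    (ψ : Y₂ →ₗ[ℤ] Y₃) (hψ : ∀ g, ψ ∘ₗ ρ₂ g = ρ₃ g ∘ₗ ψ) (hsurj : Function.Surjective ψ) :
    Submodule.map ψ (Coinvariants.ker ρ₂) = Coinvariants.ker ρ₃ := by
  have hψ' : ∀ g v, ψ (ρ₂ g v) = ρ₃ g (ψ v) := fun g v => by
    simpa using LinearMap.congr_fun (hψ g) v
  rw [Coinvariants.ker, Coinvariants.ker, Submodule.map_span]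
  congr 1
  ext y
  constructor
  · rintro ⟨x, ⟨⟨g, v⟩, rfl⟩, rfl⟩
    exact ⟨(g, ψ v), by simp [hψ']⟩
  · rintro ⟨⟨g, w⟩, rfl⟩
    obtain ⟨v, rfl⟩ := hsurj w
    exact ⟨ρ₂ g v - v, ⟨(g, v), rfl⟩, by simp [hψ']⟩

end HoldsAux

/-- Discharge of `Kottwitz1985_2_2_a_coinvariants` («an easy exercise», p. 206): (2.1.1) by the augmentation
(`nonempty_coinvariants_equiv`, base point the class of `1` in `G/N`); (2.1.2) surjectivity on coinvariants from the
surjectivity of `ψ`, and exactness at the middle term from `ψ(⟨ρ₂(g) y - y⟩) = ⟨ρ₃(g) y - y⟩` and `ker ψ = im φ`.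
[cite: Kottwitz1985Isocrystals, Lemma 2.2 (a) (p. 206)] -/
theorem Kottwitz1985_2_2_a_coinvariants_holds :
    ∀ (Q : Type) [Field Q] (K : Type) [Field K] [Algebra Q K], Kottwitz1985_2_2_a_coinvariants Q K := by
  intro Q _ K _ _
  refine ⟨fun N _ => nonempty_coinvariants_equiv ((1 : K ≃ₐ[Q] K) : (K ≃ₐ[Q] K) ⧸ N), ?_⟩
  intro Y₁ Y₂ Y₃ _ _ _ _ _ _ _ _ _ ρ₁ ρ₂ ρ₃ φ ψ _ hψ _ hsurj hker
  refine ⟨fun c => ?_, fun y₂ => ⟨fun h => ?_, ?_⟩⟩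
  · induction c using Coinvariants.induction_on with
    | h v =>
      obtain ⟨y₂, rfl⟩ := hsurj v
      exact ⟨y₂, rfl⟩
  · have hmem : ψ y₂ ∈ Submodule.map ψ (Coinvariants.ker ρ₂) := by
      rw [map_coinvariantsKer_eq ρ₂ ρ₃ ψ hψ hsurj]
      exact (Coinvariants.mk_eq_zero _).1 h
    obtain ⟨z, hz, hψz⟩ := Submodule.mem_map.1 hmem
    have hyz : y₂ - z ∈ LinearMap.range φ := by
      rw [← hker, LinearMap.mem_ker, map_sub, hψz, sub_self]
    obtain ⟨y₁, hy₁⟩ := LinearMap.mem_range.1 hyz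
    refine ⟨y₁, (Coinvariants.mk_eq_iff _).2 ?_⟩
    rwa [hy₁, sub_sub_cancel]
  · rintro ⟨y₁, h⟩
    have h₁ : ψ (y₂ - φ y₁) ∈ Coinvariants.ker ρ₃ := by
      rw [← map_coinvariantsKer_eq ρ₂ ρ₃ ψ hψ hsurj]
      exact Submodule.mem_map_of_mem ((Coinvariants.mk_eq_iff _).1 h)
    have h₂ : ψ (φ y₁) = 0 := LinearMap.mem_ker.1 (hker ▸ LinearMap.mem_range_self φ y₁)
    rw [map_sub, h₂, sub_zero] at h₁
    exact (Coinvariants.mk_eq_zero _).2 h₁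

end Literature.NumberTheory.Kottwitz1985Isocrystals.CitedRows

/-! ## ED. 4 (paydown, DEAL v4 P-a): discharge of the key step of Proposition 2.3 (`B(𝔾_m)`: coboundaries = units)

`Kottwitz1985_2_3_sigmaConj_one_iff_unit` is now PROVED from Mathlib's Witt-vector library
(`WittVector.frobeniusRotation` = Lang for `𝔾_m/W(k)`, `WittVector.exists_eq_pow_p_mul'` = `W(k) ∖ 0 = p^ℕ · W(k)^×`),
with the def's own parameters and no further hypothesis.  ED. 3 is byte-identical above this line; Mathlib only. -/

namespace Literature.NumberTheory.Kottwitz1985Isocrystals.CitedRows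

section HoldsWitt

variable {p : ℕ} [Fact p.Prime] {k : Type} [Field k] [CharP k p] [IsAlgClosed k]

/-- The Frobenius of `K = Frac W(k)` restricts to the Witt-vector Frobenius on `W(k)`. [folklore] -/
private lemma frobenius_algebraMap (a : WittVector p k) :
    WittVector.FractionRing.frobenius p k (algebraMap (WittVector p k) K(p, k) a) =
      algebraMap (WittVector p k) K(p, k) (WittVector.frobenius a) := by
  rw [WittVector.FractionRing.frobenius, IsFractionRing.ringEquivOfRingEquiv_algebraMap,
    WittVector.frobeniusEquiv_apply]

/-- Lang's theorem for `𝔾_m` over `W(k)`, `k` algebraically closed (Mathlib's `frobeniusRotation`): every unit `w` of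
`W(k)` satisfies `frobenius b * w = b` for some `b ≠ 0`. [folklore] -/
private lemma exists_frobenius_mul_eq (w : (WittVector p k)ˣ) :
    ∃ b : WittVector p k, b ≠ 0 ∧ WittVector.frobenius b * w = b := by
  have hw : (w : WittVector p k).coeff 0 ≠ 0 :=
    (w.isUnit.map (WittVector.constantCoeff : WittVector p k →+* k)).ne_zero
  have h1 : (1 : WittVector p k).coeff 0 ≠ 0 := by simp
  exact ⟨WittVector.frobeniusRotation p hw h1, WittVector.frobeniusRotation_nonzero p hw h1,
    by simpa using WittVector.frobenius_frobeniusRotation p hw h1⟩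

end HoldsWitt

/-- Discharge of `Kottwitz1985_2_3_sigmaConj_one_iff_unit` (Proposition 2.3, key step, p. 207: «it is enough to show
that `x ∈ L^×` is of the form `y σ(y)⁻¹` if and only if `x` is a unit of `W(k)`»).  (⇐) is Lang's theorem for `𝔾_m`
over `W(k)` — Mathlib's `WittVector.frobeniusRotation` solves `frobenius b · w = b` with `b ≠ 0` for a unit `w`;
(⇒) write `eL y = p^m u / (p^n v)` with `u, v ∈ W(k)^×` (`WittVector.exists_eq_pow_p_mul'`), so that
`y σ(y)⁻¹ ↦ u φ(v) / (v φ(u)) ∈ W(k)^×` since `φ(p) = p`.  Uses only `(IsLDatum).2.1` (`eL ∘ σ = φ ∘ eL`).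
[cite: Kottwitz1985Isocrystals, Proposition 2.3, proof (p. 207)] -/
theorem Kottwitz1985_2_3_sigmaConj_one_iff_unit_holds :
    ∀ (p : ℕ) [Fact p.Prime] (k : Type) [Field k] [CharP k p] [IsAlgClosed k] (Q : Type) [Field Q]
      (L : Type) [Field L] [Algebra Q L] (σ : L ≃ₐ[Q] L) (eL : L ≃+* K(p, k)),
      Kottwitz1985_2_3_sigmaConj_one_iff_unit p k Q L σ eL := by
  intro p _ k _ _ _ Q _ L _ _ σ eL hL x
  obtain ⟨-, hσ, -⟩ := hL
  have hP : (p : K(p, k)) ≠ 0 := WittVector.FractionRing.p_nonzero p k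
  have hU : ∀ u : (WittVector p k)ˣ, algebraMap (WittVector p k) K(p, k) u ≠ 0 := fun u =>
    (u.isUnit.map (algebraMap (WittVector p k) K(p, k))).ne_zero
  constructor
  · rintro ⟨y, hy⟩
    have hy0 : eL (y : L) ≠ 0 := by simp
    obtain ⟨r, q, hq, hrq⟩ := IsFractionRing.div_surjective (A := WittVector p k) (eL (y : L))
    have hq0 : q ≠ 0 := nonZeroDivisors.ne_zero hq
    have hr0 : r ≠ 0 := by
      rintro rfl
      rw [map_zero, zero_div] at hrq
      exact hy0 hrq.symm
    obtain ⟨m, u, hu⟩ := WittVector.exists_eq_pow_p_mul' r hr0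
    obtain ⟨n, v, hv⟩ := WittVector.exists_eq_pow_p_mul' q hq0
    refine ⟨u * Units.map (WittVector.frobenius : WittVector p k →+* WittVector p k).toMonoidHom v *
      (v * Units.map (WittVector.frobenius : WittVector p k →+* WittVector p k).toMonoidHom u)⁻¹, ?_⟩
    have hx : eL (x : L) = eL y * (WittVector.FractionRing.frobenius p k (eL y))⁻¹ := by
      rw [hy, map_mul, map_inv₀, hσ]
    have hU' : ∀ u : (WittVector p k)ˣ, algebraMap (WittVector p k) K(p, k) (WittVector.frobenius u) ≠ 0 :=
      fun u => (u.isUnit.map ((algebraMap (WittVector p k) K(p, k)).comp WittVector.frobenius)).ne_zero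
    rw [hx, ← hrq, map_div₀, frobenius_algebraMap, frobenius_algebraMap, hu, hv]
    simp only [map_mul, map_pow, map_natCast, Units.val_mul, Units.coe_map, map_units_inv,
      RingHom.toMonoidHom_eq_coe, MonoidHom.coe_coe]
    have h1 := hU u; have h2 := hU v; have h3 := hU' u; have h4 := hU' v
    field_simp
  · rintro ⟨w, hw⟩
    obtain ⟨b, hb0, hb⟩ := exists_frobenius_mul_eq w
    have hb0' : algebraMap (WittVector p k) K(p, k) b ≠ 0 := by
      simpa using (IsFractionRing.injective (WittVector p k) K(p, k)).ne hb0
    have hfb0 : algebraMap (WittVector p k) K(p, k) (WittVector.frobenius b) ≠ 0 := by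
      intro h
      rw [← frobenius_algebraMap, map_eq_zero] at h
      exact hb0' h
    have hy0 : eL.symm (algebraMap (WittVector p k) K(p, k) b) ≠ 0 := by
      simpa using hb0'
    refine ⟨Units.mk0 _ hy0, ?_⟩
    apply eL.injective
    rw [Units.val_mk0, map_mul, map_inv₀, hσ, RingEquiv.apply_symm_apply, hw, frobenius_algebraMap,
      eq_mul_inv_iff_mul_eq₀ hfb0, ← map_mul, mul_comm, hb]

end Literature.NumberTheory.Kottwitz1985Isocrystals.CitedRows
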